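import Literature.NumberTheory.Automorphic.HidaTowerHeckeCommutative
import Literature.NumberTheory.Automorphic.HidaHeckeAlgebraPointsIntegral
import Mathlib.Algebra.MvPolynomial.CommRing
import HarnessLib

/-!
# The polynomial Hecke ring `ℤ[T^abs]` of the Hida tower, its points, and continuity

Topic `NumberTheory/Automorphic`; namespace `Literature.NumberTheory.Automorphic.BigHeckeGLn.TameLevel`
(and a generic lemma in `Literature.NumberTheory.Automorphic`).  Definitions with bodies
(instances and the evaluation homomorphism `heckePolyHom`) and theorems; no named fact, no `sorry`.

The levelwise form of the support argument of Hida's control theorem ([Hida1994AIF, §3, proof of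
Thm 3.2]; [KhareThorne2017, §6.5, Lemma 6.17]) works with the FREE commutative ring
`R = ℤ[T^abs]` on the Hida elements (symbols `T_{w,j}`, `T_{w,2}⁻¹`, `U_{v,j}`, `⟨u⟩_v`) acting on
each factor `H^i(X_{U(r)}, ℤ/p^s)^{ord}` of the tower, and with the character `x̃ = x ∘ (R → 𝕋)` of a
point `x` of the ordinary big Hecke algebra `𝕋 = 𝕋^{S,ord}(𝒰)`:

* `OrdinaryHeckeAlgebraGLn.instCommRing` — for `𝒰` maximal above `p` (as a `Fact`), `𝕋` is a
  commutative ring (`OrdinaryHeckeAlgebraGLn.mul_comm_of_isMaximalAbove`);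
* `heckePolyHom 𝒰 : MvPolynomial 𝒰.hidaElements ℤ →+* 𝕋`, `X_g ↦ ordOp g`;
* `moduleOrdinaryPart` — the factor `H^i(X_{U(r)}, ℤ/p^s)^{ord}` at `y = (i, r, s)` as an
  `R`-module (through `𝕋 → End(H^{ord}_y)`), `heckePoly_smul_def`,
  `forall_heckePoly_smul_eq_zero_iff` (`z` kills the factor iff the `y`-component of its image in
  `𝕋` vanishes);
* `exists_finset_forall_norm_lt` (generic) and **`exists_finset_forall_norm_apply_heckePolyHom_lt`**
  — CONTINUITY of `x`: for every `ε > 0` there is a finite set `Σ_ε` of indices such that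
  `‖x(z)‖ < ε` for every `z ∈ R` whose image kills the factors at `Σ_ε` (the subspace topology of
  the product of discrete rings). [cite: Hida1994AIF, §3] [cite: KhareThorne2017, §6.5]

## References

* H. Hida, Ann. Inst. Fourier 44 (1994), §3. [Hida1994AIF]
* C. Khare, J. A. Thorne, Amer. J. Math. 139 (2017), §6.5. [KhareThorne2017]
-/

noncomputable section

open scoped NumberField

namespace Literature.NumberTheory.Automorphic

/-! ### Generic: continuity on a subring of a product of topological rings -/

/-- **Continuity at `0` in the subspace topology of a product**: for a continuous ring homomorphism
`φ` from a subring `𝕋 ⊆ ∏ᵢ Rᵢ` (subspace of the product topology) to a normed ring and every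
`ε > 0`, there is a finite set `I` of indices with `‖φ T‖ < ε` whenever `Tᵢ = 0` for all `i ∈ I`
(as in `norm_apply_le_one_of_continuous_of_pow_eq_zero`). [folklore] -/
theorem exists_finset_forall_norm_lt {ι : Type*} {R : ι → Type*}
    [∀ i, Ring (R i)] [∀ i, TopologicalSpace (R i)] (𝕋 : Subring (∀ i, R i)) {A : Type*}
    [NormedRing A] (φ : 𝕋 →+* A) (hφ : Continuous φ) {ε : ℝ} (hε : 0 < ε) :
    ∃ I : Finset ι, ∀ T : 𝕋, (∀ i ∈ I, (T : ∀ i, R i) i = 0) → ‖φ T‖ < ε := by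
  have hopen : IsOpen ((φ : 𝕋 → A) ⁻¹' Metric.ball 0 ε) := Metric.isOpen_ball.preimage hφ
  obtain ⟨U, hU, hUeq⟩ := isOpen_induced_iff.1 hopen
  have h0 : (0 : ∀ i, R i) ∈ U := by
    have h : (0 : 𝕋) ∈ (φ : 𝕋 → A) ⁻¹' Metric.ball 0 ε := by simp [hε]
    rw [← hUeq] at h
    exact h
  obtain ⟨I, u, hu, hsub⟩ := isOpen_pi_iff.1 hU 0 h0
  refine ⟨I, fun T hT => ?_⟩
  have hTU : (T : ∀ i, R i) ∈ U := hsub (Set.mem_pi.2 fun i hi => by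
    rw [hT i (Finset.mem_coe.1 hi)]
    exact (hu i (Finset.mem_coe.1 hi)).2)
  have h : T ∈ (φ : 𝕋 → A) ⁻¹' Metric.ball 0 ε := by
    rw [← hUeq]
    exact hTU
  simpa using h

namespace BigHeckeGLn

namespace TameLevel

variable {K : Type} [Field K] [NumberField K] {p : ℕ} [Fact p.Prime] (𝒰 : TameLevel 2 K p)

/-! ### `𝕋^{S,ord}(𝒰)` is a commutative ring (`GL₂`, `𝒰` maximal above `p`) -/

/-- **`𝕋^{S,ord}(𝒰)` as a commutative ring** (`GL₂`, `𝒰` maximal above `p` recorded as a `Fact`).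
[cite: Hida1994AIF, §2] -/
instance OrdinaryHeckeAlgebraGLn.instCommRing [h𝒰 : Fact 𝒰.IsMaximalAbove] :
    CommRing (OrdinaryHeckeAlgebraGLn 𝒰) :=
  { (inferInstance : Ring (OrdinaryHeckeAlgebraGLn 𝒰)) with
    mul_comm := OrdinaryHeckeAlgebraGLn.mul_comm_of_isMaximalAbove h𝒰.out }

/-! ### The polynomial Hecke ring and its evaluation in `𝕋` -/

/-- **`ℤ[T^abs] → 𝕋^{S,ord}(𝒰)`**, `X_g ↦ ordOp g` for the Hida elements `g`.
[cite: KhareThorne2017, §6.5 (𝕋^S → 𝕋^S_ord(U))] -/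
def heckePolyHom [Fact 𝒰.IsMaximalAbove] : MvPolynomial 𝒰.hidaElements ℤ →+* OrdinaryHeckeAlgebraGLn 𝒰 :=
  MvPolynomial.eval₂Hom (Int.castRingHom _) fun g => 𝒰.ordOp g.2

/-- `heckePolyHom (X_g) = ordOp g`. [folklore] -/
@[simp]
theorem heckePolyHom_X [Fact 𝒰.IsMaximalAbove] (g : 𝒰.hidaElements) :
    𝒰.heckePolyHom (MvPolynomial.X g) = 𝒰.ordOp g.2 := by
  rw [heckePolyHom, MvPolynomial.coe_eval₂Hom, MvPolynomial.eval₂_X]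

/-! ### The tower factors as `ℤ[T^abs]`-modules -/

/-- The factor `H^{ord}_y` as a module over `End(H^{ord}_y)` (evaluation). [folklore] -/
instance moduleOrdEndFactor (k : Type) [CommRing k] (y : TowerIndex) :
    Module (𝒰.OrdEndFactor k y) (𝒰.ordinaryPart k y) :=
  inferInstanceAs (Module (Module.End k (𝒰.ordinaryPart k y)) (𝒰.ordinaryPart k y))

/-- The factor `H^{ord}_y` as a module over the product `∏_x End(H^{ord}_x)` (through the
`y`-component). [folklore] -/
instance moduleOrdEndProd (k : Type) [CommRing k] (y : TowerIndex) :
    Module (𝒰.ordEndProd k) (𝒰.ordinaryPart k y) :=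
  Module.compHom _ (Pi.evalRingHom (𝒰.OrdEndFactor k) y)

/-- **The factor `H^i(X_{U(r)}, ℤ/p^s)^{ord}` at `y = (i, r, s)` as a `ℤ[T^abs]`-module.**
[cite: KhareThorne2017, §6.5] -/
instance moduleOrdinaryPart [Fact 𝒰.IsMaximalAbove] (y : TowerIndex) :
    Module (MvPolynomial 𝒰.hidaElements ℤ) (𝒰.ordinaryPart ℤ y) :=
  Module.compHom _ ((𝒰.ordHeckeSubring ℤ).subtype.comp 𝒰.heckePolyHom)

/-- Unfolding the `ℤ[T^abs]`-action: `z • m = (heckePolyHom z)_y m`. [folklore] -/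
theorem heckePoly_smul_def [Fact 𝒰.IsMaximalAbove] (y : TowerIndex) (z : MvPolynomial 𝒰.hidaElements ℤ)
    (m : 𝒰.ordinaryPart ℤ y) :
    z • m = ((𝒰.heckePolyHom z : OrdinaryHeckeAlgebraGLn 𝒰) : 𝒰.ordEndProd ℤ) y m :=
  rfl

/-- **`z` kills the factor at `y` iff the `y`-component of its image in `𝕋` vanishes.** [folklore] -/
theorem forall_heckePoly_smul_eq_zero_iff [Fact 𝒰.IsMaximalAbove] (y : TowerIndex)
    (z : MvPolynomial 𝒰.hidaElements ℤ) :
    (∀ m : 𝒰.ordinaryPart ℤ y, z • m = 0) ↔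
      ((𝒰.heckePolyHom z : OrdinaryHeckeAlgebraGLn 𝒰) : 𝒰.ordEndProd ℤ) y = 0 := by
  constructor
  · intro h
    exact DFunLike.ext _ _ fun m => h m
  · intro h m
    rw [heckePoly_smul_def, h]
    rfl

/-! ### Continuity of a point: small values on operators killing finitely many factors -/

/-- **Continuity of `x : 𝕋^{S,ord}(𝒰) → A`, levelwise**: for every `ε > 0` there is a finite set
`Σ_ε` of indices `(i, r, s)` such that `‖x(z)‖ < ε` for every `z ∈ ℤ[T^abs]` killing the factors
`H^i(X_{U(r)}, ℤ/p^s)^{ord}`, `(i, r, s) ∈ Σ_ε`. [cite: Hida1994AIF, §3] [cite: KhareThorne2017, §6.5] -/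
theorem exists_finset_forall_norm_apply_heckePolyHom_lt [Fact 𝒰.IsMaximalAbove] {A : Type*}
    [NormedRing A] (x : OrdinaryHeckeAlgebraGLn 𝒰 →+* A) (hx : Continuous x) {ε : ℝ} (hε : 0 < ε) :
    ∃ I : Finset TowerIndex, ∀ z : MvPolynomial 𝒰.hidaElements ℤ,
      (∀ y ∈ I, ∀ m : 𝒰.ordinaryPart ℤ y, z • m = 0) → ‖x (𝒰.heckePolyHom z)‖ < ε := by
  obtain ⟨I, hI⟩ := exists_finset_forall_norm_lt (𝒰.ordHeckeSubring ℤ) x hx hε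
  refine ⟨I, fun z hz => hI _ fun y hy => ?_⟩
  exact (𝒰.forall_heckePoly_smul_eq_zero_iff y z).1 (hz y hy)

/-- The point `x̃ = x ∘ heckePolyHom` on a symbol. [folklore] -/
theorem apply_heckePolyHom_X [Fact 𝒰.IsMaximalAbove] {A : Type*} [NormedRing A]
    (x : OrdinaryHeckeAlgebraGLn 𝒰 →+* A) (g : 𝒰.hidaElements) :
    x (𝒰.heckePolyHom (MvPolynomial.X g)) = x (𝒰.ordOp g.2) := by
  rw [heckePolyHom_X]

/-- Integrality of the point on `ℤ[T^abs]`: `‖x(z)‖ ≤ 1` (`x` continuous, `A` a normed division ring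
of characteristic zero). [cite: Hida1994AIF, §3] -/
theorem norm_apply_heckePolyHom_le_one [Fact 𝒰.IsMaximalAbove] {A : Type*} [NormedDivisionRing A]
    [CharZero A] (x : OrdinaryHeckeAlgebraGLn 𝒰 →+* A) (hx : Continuous x)
    (z : MvPolynomial 𝒰.hidaElements ℤ) : ‖x (𝒰.heckePolyHom z)‖ ≤ 1 :=
  OrdinaryHeckeAlgebraGLn.norm_apply_le_one x hx _

end TameLevel

end BigHeckeGLn

end Literature.NumberTheory.Automorphic
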